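import Mathlib
import HarnessLib
import HarnessLib.Audit
import Summits.CriticalPhenomena.Statement
import Literature.Probability.Percolation.CardyFormula
import HarnessLib.Audit.Status.Attr

/-!
Route: CardyUniqueLimit

DORMANT since 2026-08-24T23:36:18Z (reconciler: no traction for 7.2 d (last activity item-evidence-added at 2026-08-17T18:54:11Z); parked, not closed — `ledger route dormant route-CriticalPhenomena-CardyUniqueLimit --off` to reactivate) — unstaffed, not closed; items shared with open routes are served there. `ledger route dormant <id> --off` reactivates.

It suffices to show X_U [conformally invariant crossing limit]: there is ONE function f : (0,1) → ℝ
such that for every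
conformal rectangle R = (Ω; a, b, c, d) the P_{1/2} bond-ℤ² crossing probability of Ω_δ from (ab)_δ
to (cd)_δ converges, as
δ → 0⁺, to f(η), η the cross-ratio of any uniformizing datum of R (existence of the limit +
dependence on R only through its
conformal modulus). The route then closes through the crux CardyRigidity: any such f coincides with
Cardy's function on (0,1)
(locality of percolation forces the exploration limit to be SLE₆, whose crossing law is Cardy's —
LSW 2001 §3), so X_U → Cardy.

Lean: ∃ f : ℝ → ℝ, ∀ R : Literature.Probability.RandomPlanarGeometry.ConformalRectangle,
R.HasCrossingLimit (Literature.Probability.Percolation.bondDomainCrossingProb R) f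

Rationale: WHY THIS LINE. CardyFormulaZ2 = (limit exists) ∧ (limit is conformally invariant) ∧ (limit = F).
Smirnov2001 proves all three at once on 𝕋 via the harmonic triple; on ℤ² no exact observable is
known, but the last conjunct is of a different nature: it is a RIGIDITY statement importing SLE
theory (Schramm2000 principle: conformally invariant + domain-Markov chordal curves are SLE_κ;
LawlerSchrammWerner2001 §3 / Literature `eq_six_of_forall_measureReal_hitsBefore`,
`sle_six_measureReal_hitsBefore`: locality ⇔ κ = 6 ⇔ Cardy). For bond-ℤ² every ingredient of the
rigidity step except conformal invariance is available today: RSW (`rsw_half`; the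
conformal-rectangle corollary `discreteCrossingProb_clusterPt_mem_Ioo` is now PROVED in the tree as
`discreteCrossingProb_clusterPt_mem_Ioo_holds`,
Literature/Probability/Percolation/BoxCrossingJordan.lean), Aizenman–Burchard tightness
(`isTightLaws_map_bondInterface`), locality and the domain Markov property (exact on the lattice),
and rotation invariance of subsequential limits (DKKMO arXiv:2012.11672 Thm 1.2,
`dkkmo_rotation_invariance`; Tassion2024). So the route splits the conjunct into X_U (the genuinely
open symmetry statement, attackable by the DKKMO programme or by any other means) and CardyRigidity
(a theorem-sized crux provable with 2001–2007 technology: Smirnov2001 Thm 2 sketch, CamiaNewman2007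
§§5–7, Werner2007 §3, run with an unknown conformally invariant hitting kernel f in place of F and
closed by LSW locality). Area imported: SLE / stochastic Loewner theory as an identification device.
No new objects.

RANKED CRUXES.
 r2 CardyRigidity (typed): ∀ f, (∀ R, R.HasCrossingLimit (bondDomainCrossingProb R) f) → EqOn f
cardyFunction (Ioo 0 1). Most informative: turns "conformal invariance of crossing probabilities"
into the full conjunct; its proof is the ℤ²-version of "Cardy ⇒ SLE₆" run backwards through locality
(why it might fail AS A THEOREM: the hypothesis quantifies over Jordan conformal rectangles only,
while CamiaNewman2007 Thm 2–3 use crossing kernels in admissible non-Jordan domains with moving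
mesh, p. 489; sources CamiaNewman2007, Schramm2000, LawlerSchrammWerner2001, Werner2007,
KemppainenSmirnov2017). As a PROPOSITION it is true iff (X_U → CardyFormulaZ2): the hypothesis is
about the real bond-ℤ² crossing probabilities, so it is vacuous unless X_U holds. Shared verbatim
with CardyCapacityWard / CardyWhiteToColoured / CardyQContinuation (stmt-CriticalPhenomena-0746).
 r3 LimitExists (typed): ∀ R, ∃ L, bondDomainCrossingProb R δ → L as δ → 0⁺ (existence only).
Necessary; open (GrimmettPercolation1999 §11.10 p. 346, BollobasRiordan2006 Ch. 7 Conjecture 1,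
Grimmett2018 p. 176). Every cluster point lies in (0,1) by the proved RSW corollary
`discreteCrossingProb_clusterPt_mem_Ioo_holds`, so the whole content is UNIQUENESS of the cluster
point; the natural target of sub/super-multiplicativity or monotone-coupling ideas.
 r4 ConfInvTransport (typed; route-choice repair rev 7, 2026-08-16): conformal invariance of the
bond-ℤ² crossing limit in TRANSPORT form — if R, R' admit uniformizing data of equal cross-ratio and
bondDomainCrossingProb R δ → L, then bondDomainCrossingProb R' δ → L. Verbatim the shared crux
stmt-CriticalPhenomena-0794 (CardyHarmonicInvariants r4, CardyOrderDuality r5, CardyMonotoneApproach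
r4, CardyHausdorffMoment r5; grounded and refuter-checked there), re-asked here so that the target
is REACHED inside the route: X_U ⟸ LimitExists ∧ ConfInvTransport by the support glue
LimitTransportGlue (below), and conversely X_U ⇒ ConfInvTransport (limits along 𝓝[>]0 are unique)
and X_U ⇒ LimitExists (given uniformizing data, Literature exists_isUniformizing_holds), so the
split is faithful: the two cruxes are separately necessary and jointly sufficient for X_U. Why it
might fail: it IS Schramm2007ICM Problem 2.11 / BollobasRiordan2006 Ch. 7 Conj. 1 minus existence;
false if ℤ² limits are only similarity-invariant; EmbeddingModulusUniqueness (Beffara2008Universal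
Prop. 4) forbids embedding-blind proofs and only DKKMO rotations (arXiv:2012.11672) are in hand.
Ranked below r2/r3 because its attack is carried by the sibling routes that share it (and by
CardyRotToConf / CardyViaSLE6 at interface level); this route's own deliverable remains r2.
 Support LimitTransportGlue (rank 9, PROVABLE NOW): LimitExists → ConfInvTransport →
CardyUniqueLimitThesis. Proof (sorry-free in the planner's Sketch.lean, `limitTransportGlue_holds`,
axioms propext/choice/Quot.sound): put f η := the r3-limit of SOME conformal rectangle admitting a
uniformizing datum of cross-ratio η (junk 0 if none); for R with datum (φ, x) the chosen witness of
η = crossRatio x has limit f η, and r4 transports it to R. Uses neither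
crossRatio_eq_of_isUniformizing nor exists_isUniformizing.
 Target X_U (CardyUniqueLimitThesis, stmt-CriticalPhenomena-0745; also crux r4 of
CardyPerronTeleport) rank 0, now concluded by LimitTransportGlue; Assembly rank 1: X_U →
CardyRigidity → CardyFormulaZ2. The deciding theorem `closes (hX : CardyUniqueLimitThesis) (hR :
CardyRigidity) : CardyFormulaZ2` is unchanged (certified native, rev 5:
crossRatio_mem_Ioo_of_isUniformizing + EqOn rewrite); through the glue the route reads LimitExists →
ConfInvTransport → CardyRigidity → CardyFormulaZ2 (checked as `closes_via_cruxes` in the sketch).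
 Settled negative (rev 4, 2026-08-15): the rank-6 refutation guard NegDegenerateArcs (∃ R, ∃ᶠ δ →
0⁺, bondDomainCrossingProb R δ = 0) was REFUTED by
Theorems.CardyUniqueLimitNegDegenerateArcs_refuted, unconditionally, from
`discreteCrossingProb_clusterPt_mem_Ioo_holds` ("frequently = 0" makes 0 a cluster point at 0⁺;
every cluster point lies in (0,1)): the G02 discretisation is non-degenerate for EVERY Jordan
conformal rectangle, so the conjunct is not junk-refutable through empty discrete arcs. Dropped from
the route (not load-bearing), kept in the negatives index; no reworded guard is re-filed.

KILL CRITERIA. ¬LimitExists (two distinct cluster points in (0,1) for one conformal rectangle R) or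
¬ConfInvTransport (two conformally equivalent marked rectangles, e.g. a square and its image under a
non-similarity conformal map, with different limits) each refute conformal invariance on bond-ℤ² and
hence the conjunct itself: close --reason refuted:<Decl>, and every sibling sharing the item breaks
with it. ¬CardyRigidity cannot hold unless CardyFormulaZ2 fails (given X_U it is equivalent to the
conjunct; without X_U it is vacuously true), so a refutation of r2 is a refutation of the summit
conjunct, not a pivot. Degenerate-discretisation kills are excluded since rev 4 (NegDegenerateArcs
refuted). X_U proved elsewhere with the value of the limit left unidentified (CardyPerronTeleport
r4, CardyWhiteToColoured, CardyCapacityWard; CardyViaSLE6 / CardyRotToConf at interface level) does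
not moot this route — r2 is then the last step; a sibling route that identifies the limit as F
directly (an exact observable, CardyHarmonicInvariants) moots it (close --reason superseded --by
<that route>).

NOT DECOMPOSED YET: the interior of r4 ConfInvTransport — HOW conformal invariance of the crossing
limit is to be obtained (DKKMO rotation invariance + scale invariance/uniqueness + a
similarity-to-Möbius upgrade, as in CardyRotToConf r2/r3 and CardyWhiteToColoured's
SimilarityUpgrade; or an exact ℤ² observable, CardyHarmonicInvariants) — is deliberately left to the
sibling routes that share stmt-0794 / attack X_U; a glued split of r4 here (k ≤ 3, depth 1) is filed
only if one of those lines produces a crossing-level intermediate statement worth sharing. The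
interior of r2 (hitting-kernel skeleton, Aizenman–Burchard regularity, Loewner parametrisability of
subsequential interface limits, and the passage from Jordan conformal rectangles to
CamiaNewman2007-admissible slit domains via RSW a-priori bounds, KemppainenSmirnov2017 Thm 1.3 /
§4.2) stays undecomposed until r2 is grounded — these are layer-2 children of r2, to be filed as a
glued split (k ≤ 3) only after grounding. r3 is atomic (uniqueness of the cluster point).

CHEAPEST FALSIFIER. For the line as a whole: two separated cluster points of δ ↦
bondDomainCrossingProb R δ for ONE rectangle R (¬LimitExists) — cheapest probe: certified
transfer-matrix / Monte-Carlo values of the p = 1/2 bond crossing probability of the unit square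
along δ = 2^-k versus δ = 3^-k; the ℤ² numerics of Langlands–Pouliot–Saint-Aubin (arXiv:math/9401222
§3.2) agree with Cardy's values to ~5e-3, so no kill is expected. For r2 as a theorem: check on
paper whether CamiaNewman2007 Thm 3 (p. 489, "Jordan domains only would not suffice") genuinely
needs crossing kernels of non-Jordan slit domains as INPUT, or whether the RSW a-priori arm bounds
of KemppainenSmirnov2017 §4.2 let Jordan approximations carry the hypothesis; a negative answer
forces a restatement of r2 over admissible domains (route edit --restate), it does not kill the
line. For r4: the two-domain probe of Langlands–Pouliot–Saint-Aubin — Monte-Carlo / transfer-matrix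
crossing values at p = 1/2 for a rectangle versus a conformally equivalent parallelogram (vertices
to vertices) at several inclinations to the lattice axes: a gap persisting beyond ~1e-2 as δ ↓ would
signal ¬ConfInvTransport; the published square-lattice data (arXiv:math/9401222 §3.3, Table 3.3 and
p. 22: parallelograms of angle απ, α = 1/2, 3/8, 1/4, 1/8, at four inclinations, worst discrepancies
from Cardy's values 2.4e-3 … 5.7e-3 at the rows with π^cft = .5; site model M_0 on ℤ², the bond
model entering through their universality checks) show no such gap, so no kill is expected.

Novelty: NOVELTY (thesis level; searches run 2026-08-14: lit search --hybrid / lit vsearch on "conformally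
invariant crossing limit ⇒ Cardy via SLE6 locality", lit search CN2007 + Kemppainen–Smirnov, lit
frontier CriticalPhenomena --since 2020 (0 descendants on ℤ² conformal invariance), lit read of
every source quoted below; remote APIs rate-limited, local store + citation graph used).
Nearest prior art FOUND:
 (a) Schramm2000 (arXiv:math/9904022 §1.5, pp. 8–9): "under the assumption of a conformal invariance
conjecture for the scaling limit of critical percolation … the claim is that for κ = 6 [SLE] has the
same distribution as γ. From this, one can derive Cardy's conjectured formula" — the invariance ⇒
value mechanism, hypothesis at the level of the exploration-CURVE law; same in Lawler2005 (PDF p.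
16: locality ⇒ "κ = 6 … the only possibility for the limit") and Werner2007 (arXiv:0710.0856 §3 p.
19; §3.8 p. 25 identifies κ through the EXPLICIT Cardy–Carleson map).
 (b) LawlerSchrammWerner2001 (arXiv:math/9911084 §2 locality ⇔ κ = 6, §3 SLE₆ crossing law) = tree
facts Literature.Probability.RandomPlanarGeometry.eq_six_of_forall_measureReal_hitsBefore /
sle_six_measureReal_hitsBefore.
 (c) Smirnov2001 Thm 2 / CamiaNewman2007 (doi:10.1007/s00440-006-0049-7, Thm 2 p. 486, Thm 3 pp.
488–489): crossing kernel + spatial Markov ⇒ SLE₆, run on 𝕋 with the explicit value F and for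
admissible non-Jordan domains with moving mesh.
 (d) KemppainenSmirnov2017 (arXiv:1212.6215 Thm 1.3, §4.2): RSW-ty  [refs: 10.1007/s00440-006-0049-7, math/9904022, 0710.0856, math/9911084, 1212.6215, math/9401222, doi:10.1007/s00440-006-0049-7, Schramm2000, Lawler2005, Werner2007, LawlerSchrammWerner2001, Smirnov2001, CamiaNewman2007, KemppainenSmirnov2017, BollobasRiordan2006]

Barriers (technique_class: sle6-identification schramm-principle locality unknown-f): BARRIERS (catalogue Literature/Barriers/CriticalPhenomena/*, read 2026-08-14):
- Literature.Barriers.CriticalPhenomena.EmbeddingModulusUniqueness (Beffara2008Universal Prop. 4,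
arXiv:0708.3908 p. 6; proved in tree from BeffaraShearDistortsModulus): APPLIES to the target
CardyUniqueLimitThesis (X_U), which the barrier's `blocks` field names explicitly — no
embedding-blind (shear-covariant / RSW-only / renormalisation) argument can prove that bond-ℤ²
crossing limits are functions of the conformal modulus. The route does NOT evade it: X_U is
deliberately left undecomposed (rank-0 target; sibling routes CardyRotToConf / CardyViaSLE6 /
CardyHarmonicInvariants carry the attack), and any later split of X_U must import an
embedding-specific input — evasion (i) of the barrier: the exact π/2 symmetry of ℤ² ⊂ ℂ plus
Literature.Probability.Percolation.dkkmo_rotation_invariance (DKKMO2020Rotational Thm 1.2 / Cor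
1.3), or (ii) an integrable observable. NOT applicable to the cruxes: CardyRigidity carries the
embedding-specific symmetry inside its hypothesis (for a sheared copy φ_β(ℤ²), β ≠ i, the hypothesis
is false by the barrier itself, so the implication is not shear-invariant content — same exemption
the barrier grants CardyRotToConfR2SymmetryUpgrade), and LimitExists is existence-only (named as not
blocked in the barrier text).
- Literature.Barriers.CriticalPhenomena.SmirnovTriangularOnly (Beffara ψ-criterion; Schramm2007ICM
Problem 2.11): does not apply — the route uses no colour swit

History (route lifecycle, newest last):
- 2026-08-15T18:15:23Z · BROKEN — NegDegenerateArcs (stmt-CriticalPhenomena-0748, support) refuted by Summit.CriticalPhenomena.CardyFormulaZ2.Theorems.CardyUniqueLimitNegDegenerateArcs_refuted @ 4517316a9261 (refuter-rreview1-CriticalPhenomena-CardyUniqueL-3f843bef-0)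
- 2026-08-15T18:24:41Z · rev 4: dropped NegDegenerateArcs — repair: NegDegenerateArcs (stmt-CriticalPhenomena-0748, support, rank 6) refuted by Summit.CriticalPhenomena.CardyFormulaZ2.Theorems.CardyUniqueLimitNegDegenera (planner-rfix-CriticalPhenomena-CardyUniqueLi-3f843bef-0)
- 2026-08-15T18:24:41Z · REPAIRED (drop NegDegenerateArcs) — back to open: repair: NegDegenerateArcs (stmt-CriticalPhenomena-0748, support, rank 6) refuted by Summit.CriticalPhenomena.CardyFormulaZ2.Theorems.CardyUniqueLimitNegDegenera (planner-rfix-CriticalPhenomena-CardyUniqueLi-3f843bef-0)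
- 2026-08-16T03:50:58Z · AUTO-CRUX (backfill): CardyUniqueLimitThesis — hypotheses of the deciding theorem that nothing in the route derives are cruxes (operator:999:586464)
- 2026-08-24T23:36:18Z · DORMANT — reconciler: no traction for 7.2 d (last activity item-evidence-added at 2026-08-17T18:54:11Z); parked, not closed — `ledger route dormant route-CriticalPhenomen (operator:999:686588)

sub-problem: CardyFormulaZ2 · status: dormant · opened planner-plan-CriticalPhenomena-CardyFormulaZ2-0 2026-08-13T19:07:47Z · rev 7 · ledger route-CriticalPhenomena-CardyUniqueLimit
GENERATED by the gate from the ledger (D-0016/17). Provers cite these decls: `theorem foo : Summit.CriticalPhenomena.CardyFormulaZ2.Theses.CardyUniqueLimit.<Decl> := …` in Summits/CriticalPhenomena/CardyFormulaZ2/Theorems/<Name>.lean.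
-/

namespace Summit.CriticalPhenomena.CardyFormulaZ2.Theses.CardyUniqueLimit

open scoped BigOperators Topology Manifold Classical MeasureTheory ProbabilityTheory Matrix InnerProductSpace ComplexConjugate ContinuousMap
open Filter Set Function TopologicalSpace MeasureTheory

attribute [summit_statement] _root_.CardyFormulaZ2

/-- item stmt-CriticalPhenomena-0745 · crux (kind.auto-crux: conjecture-grade) · rank 0 · open · by planner
why it might fail: X_U = Aizenman/LPSA hypothesis for bond-Z^2, open (B-R2006 Ch7 Conj 1; Grimmett2018 p176); proved only on T (Smirnov2001). Fails if subsequential limits are non-unique (¬LimitExists) or only similarity-, not Möbius-invariant; EmbeddingModulusUniqueness: no embedding-blind proof (Beffara2008 Prop 4).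
sources: BollobasRiordan2006 Ch.7 Conjecture 1 (PDF pp159-162), arXiv:math/9401222 (LPSA1994, §2 hypotheses, §3.2 numerics), arXiv:0708.3908 (Beffara2008Universal, Prop 4 + Introduction p2), arXiv:0909.4499 (Smirnov2009CriticalPercolation, Thm 1 + Cor 2: T only), Schramm2007ICM Problem 2.11, lean:Literature.Barriers.CriticalPhenomena.EmbeddingModulusUniqueness
[target] X_U: bond-Z^2 crossing probabilities at p=1/2 have a scaling limit depending on the
conformal rectangle only through its cross-ratio: one f : ℝ → ℝ with bondDomainCrossingProb R δ →
f(η(R)) for every R (existence + conformal invariance, value unspecified). Smirnov2001 Thm 1 gives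
this with f = F on the triangular lattice. -/
@[route_item "route-CriticalPhenomena-CardyUniqueLimit", crux]
def CardyUniqueLimitThesis : Prop :=
  ∃ f : ℝ → ℝ, ∀ R : Literature.Probability.RandomPlanarGeometry.ConformalRectangle, R.HasCrossingLimit (Literature.Probability.Percolation.bondDomainCrossingProb R) f

/-- item stmt-CriticalPhenomena-0746 · crux · rank 2 · open · by planner
why it might fail: False only if X_U holds with f ≠ F (conf.-invariant non-Cardy Z^2 limit; LPSA94 §3.2 numerics match Cardy to 5e-3). As THEOREM: hypothesis = fixed Jordan rectangles, but CN2007 Thm 2-3 need kernels in admissible non-Jordan domains, moving mesh, explicit F (p489 'Jordan only would not suffice').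
sources: doi:10.1007/s00440-006-0049-7 (CamiaNewman2007, Thm 2 p486, Thm 3 + remark pp488-489), arXiv:math/9904022 (Schramm2000, §1.5 pp8-9: conformal invariance conjecture ⇒ κ=6 ⇒ Cardy), arXiv:math/9911084 (LawlerSchrammWerner2001, §2 locality, §3 SLE6 crossing law), arXiv:0710.0856 (Werner2007, §3 p19, §3.8 p25), arXiv:1212.6215 (KemppainenSmirnov2017, Thm 1.3; §4.2 RSW check), arXiv:math/9401222 (LPSA1994, §3.2 pp20-22)
[crux] Cardy rigidity on Z^2: if the bond-Z^2 crossing probabilities of ALL conformal rectangles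
converge to a function f of the cross-ratio, then f = cardyFunction on (0,1). Intended proof: with f
as hitting kernel, Smirnov2001 Thm 2 / CamiaNewman2007 §§5-7 / Werner2007 §4 give convergence of the
exploration path (AB tightness isTightLaws_map_bondInterface, RSW rsw_half) to a conformally
invariant domain-Markov curve = SLE_κ (Schramm2000); percolation locality forces κ = 6
(LawlerSchrammWerner2001 §3, cf. eq_six_of_forall_measureReal_hitsBefore) and
sle_six_measureReal_hitsBefore returns f = F. Vacuous unless X_U holds, but provable
unconditionally. -/
@[route_item "route-CriticalPhenomena-CardyUniqueLimit", crux]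
def CardyRigidity : Prop :=
  ∀ f : ℝ → ℝ, (∀ R : Literature.Probability.RandomPlanarGeometry.ConformalRectangle, R.HasCrossingLimit (Literature.Probability.Percolation.bondDomainCrossingProb R) f) → Set.EqOn f Literature.Probability.RandomPlanarGeometry.cardyFunction (Set.Ioo 0 1)

/-- item stmt-CriticalPhenomena-0747 · crux · rank 3 · open · by planner
why it might fail: RSW only bounds the cluster points of p(δ): all lie in (0,1) (PROVED in tree: discreteCrossingProb_clusterPt_mem_Ioo_holds). No monotonicity/sub-multiplicativity in δ is known, so p(δ) may oscillate between two cluster points (δ=2^-k vs 3^-k). Open: Grimmett1999 §11.10, B-R2006 Ch7 Conj 1.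
sources: GrimmettPercolation1999 §11.10 p346 (PDF p359) and Thm 11.70 p315 (PDF p328), BollobasRiordan2006 Ch.7 Conjecture 1 (PDF p159), Grimmett2018 PDF p176 ('principal open problem'), lean:Literature.Probability.Percolation.discreteCrossingProb_clusterPt_mem_Ioo_holds, lean:Literature.Probability.Percolation.rsw_half
[crux] Existence of the scaling limit of bond-Z^2 crossing probabilities at p=1/2 for every
conformal rectangle (no identification, no conformal invariance). Open (Grimmett1999 §9.7
conjecture; only RSW bounds on cluster points are known: discreteCrossingProb_clusterPt_mem_Ioo).
Necessary for the conjunct. -/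
@[route_item "route-CriticalPhenomena-CardyUniqueLimit", crux]
def LimitExists : Prop :=
  ∀ R : Literature.Probability.RandomPlanarGeometry.ConformalRectangle, ∃ L : ℝ, Filter.Tendsto (Literature.Probability.Percolation.bondDomainCrossingProb R) (nhdsWithin 0 (Set.Ioi 0)) (nhds L)

/-- item stmt-CriticalPhenomena-0794 · crux · rank 4 · open · by planner
why it might fail: It IS conformal invariance of the bond-ℤ² crossing limit in transport form (Schramm2007ICM Problem 2.11; BollobasRiordan2006 Ch.7 Conj.1): false if ℤ² limits are only similarity-invariant; EmbeddingModulusUniqueness (Beffara2008 Prop 4) forbids embedding-blind proofs; only DKKMO rotations are known.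
sources: Schramm2007ICM (§2.6 Problem 2.11), BollobasRiordan2006 (Ch.7 Conjecture 1, PDF p.159), arXiv:0708.3908 (Beffara2008Universal, Prop 4 p.6), arXiv:2012.11672 (DKKMO2020Rotational, Thm 1.2 / Cor 1.3, §1.1: rotations only), Smirnov2001 (Thm 1 on 𝕋; closing remark: ℤ² bond open), arXiv:math/9401222 (LPSA1994 §3.3: parallelogram numerics consistent with invariance)
[crux] Conformal invariance of crossing limits on Z^2, transport form: two conformal rectangles with
uniformizing data of equal cross-ratio have the same limiting crossing probability whenever one of
them has a limit (Z^2 analogue of Literature tendsto_triDomainCrossingProb_of_crossRatio_eq).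
Consequence of X_H; open. -/
@[route_item "route-CriticalPhenomena-CardyUniqueLimit"]
def ConfInvTransport : Prop :=
  ∀ (R R' : Literature.Probability.RandomPlanarGeometry.ConformalRectangle) (φ : Literature.Probability.RandomPlanarGeometry.ConformalEquiv UpperHalfPlane.upperHalfPlaneSet R.carrier) (x : Fin 4 → ℝ) (φ' : Literature.Probability.RandomPlanarGeometry.ConformalEquiv UpperHalfPlane.upperHalfPlaneSet R'.carrier) (x' : Fin 4 → ℝ), R.IsUniformizing φ x → R'.IsUniformizing φ' x' → Literature.Probability.RandomPlanarGeometry.crossRatio x = Literature.Probability.RandomPlanarGeometry.crossRatio x' → ∀ L : ℝ, Filter.Tendsto (Literature.Probability.Percolation.bondDomainCrossingProb R) (nhdsWithin 0 (Set.Ioi 0)) (nhds L) → Filter.Tendsto (Literature.Probability.Percolation.bondDomainCrossingProb R') (nhdsWithin 0 (Set.Ioi 0)) (nhds L)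

/-- item stmt-CriticalPhenomena-14241 · support · rank 9 · closed · proved by Summit.CriticalPhenomena.CardyFormulaZ2.Theorems.limitTransportGlue_proof @ 91f80d50ff3a (prover) · by planner
sources: Smirnov2001 (Thm 1: the form of X_U on 𝕋), lean:Literature.Probability.RandomPlanarGeometry.ConformalRectangle.HasCrossingLimit, planner Sketch.lean (limitTransportGlue_holds, rc0 2026-08-16)
[support] GLUE making the target reachable (route-choice repair 2026-08-16): LimitExists →
ConfInvTransport → CardyUniqueLimitThesis. PROVABLE NOW — proved sorry-free in the planner's
Sketch.lean (`limitTransportGlue_holds`, attached as evidence; axioms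
propext/Classical.choice/Quot.sound): classically put f η := the LimitExists-limit of SOME conformal
rectangle admitting a uniformizing datum of cross-ratio η (junk 0 if there is none); for R with
uniformizing datum (φ, x), the chosen witness R'' of η = crossRatio x has bondDomainCrossingProb R''
δ → f η, and ConfInvTransport R'' R … transports this limit to R, which is R.HasCrossingLimit
(bondDomainCrossingProb R) f at (φ, x). Pure logic + choice: uses neither
crossRatio_eq_of_isUniformizing nor exists_isUniformizing. [deps: LimitExists, ConfInvTransport,
CardyUniqueLimitThesis] [difficulty: provable-now] -/
@[route_item "route-CriticalPhenomena-CardyUniqueLimit"]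
def LimitTransportGlue : Prop :=
  LimitExists → ConfInvTransport → CardyUniqueLimitThesis

/-- item stmt-CriticalPhenomena-0749 · assembly · rank 1 · open · by planner
[assembly] X_U → CardyRigidity → CardyFormulaZ2. Proof (checked in planner sketch): given R, φ, x
uniformizing, η = crossRatio x ∈ (0,1) by ConformalRectangle.crossRatio_mem_Ioo_of_isUniformizing;
rewrite F η = f η by rigidity and apply X_U. -/
@[route_item "route-CriticalPhenomena-CardyUniqueLimit"]
def Assembly : Prop :=
  (∃ f : ℝ → ℝ, ∀ R : Literature.Probability.RandomPlanarGeometry.ConformalRectangle, R.HasCrossingLimit (Literature.Probability.Percolation.bondDomainCrossingProb R) f) → (∀ f : ℝ → ℝ, (∀ R : Literature.Probability.RandomPlanarGeometry.ConformalRectangle, R.HasCrossingLimit (Literature.Probability.Percolation.bondDomainCrossingProb R) f) → Set.EqOn f Literature.Probability.RandomPlanarGeometry.cardyFunction (Set.Ioo 0 1)) → CardyFormulaZ2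

-- records of items no longer active in this route (dropped / restated):
-- earlier NegDegenerateArcs (stmt-CriticalPhenomena-0748, dropped 2026-08-15T18:24:41Z): refuted by Summit.CriticalPhenomena.CardyFormulaZ2.Theorems.CardyUniqueLimitNegDegenerateArcs_refuted @ 4517316a9261 — ∃ R : Literature.Probability.RandomPlanarGeometry.ConformalRectangle, ∃ᶠ δ in nhdsWithin (0:ℝ) (Set.Ioi 0), Literature.Probability.Percolation.bondDomainCrossingProb R δ = 0

/-! D-0027 §2.1 — DECIDING THEOREM (planner-authored via `route open/edit --closes-file`; by planner-rbadge-CriticalPhenomena-CardyUniqueLi-3f843bef-g4-0 2026-08-15T16:08:30Z):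
its hypotheses are this route's items and its conclusion the sub-problem Statement (glue_lint), and it elaborates with this file. -/

@[closes "route-CriticalPhenomena-CardyUniqueLimit"] theorem closes (hX : CardyUniqueLimitThesis) (hR : CardyRigidity) : _root_.CardyFormulaZ2 := by
  -- D-0027 §2.1 deciding theorem: X_U (one conformally invariant crossing limit f) + Cardy rigidity
  -- (any such f agrees with cardyFunction on (0,1)) ⇒ Cardy's formula for bond-ℤ² percolation.
  -- For a uniformizing datum (φ, x) of R, η = crossRatio x ∈ (0,1), so F η = f η and X_U gives the limit.
  obtain ⟨f, hf⟩ := hX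
  have hEq : Set.EqOn f Literature.Probability.RandomPlanarGeometry.cardyFunction (Set.Ioo 0 1) :=
    hR f hf
  show ∀ R : Literature.Probability.RandomPlanarGeometry.ConformalRectangle,
      R.HasCrossingLimit (Literature.Probability.Percolation.bondDomainCrossingProb R)
        Literature.Probability.RandomPlanarGeometry.cardyFunction
  intro R φ x hφ
  have hη : Literature.Probability.RandomPlanarGeometry.crossRatio x ∈ Set.Ioo (0:ℝ) 1 :=
    Literature.Probability.RandomPlanarGeometry.ConformalRectangle.crossRatio_mem_Ioo_of_isUniformizing hφ
  rw [← hEq hη]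
  exact hf R φ x hφ

end Summit.CriticalPhenomena.CardyFormulaZ2.Theses.CardyUniqueLimit
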